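import Summits.Ventures.PercRepro.RankLevelSetLevelSevenT18Dev1
import Summits.Ventures.PercRepro.RankLevelSetLevelSevenT18Dev2
import Summits.Ventures.PercRepro.RankLevelSetLevelSevenT18Dev3
import Summits.Ventures.PercRepro.RankLevelSetLevelSevenT18Dev4
import Summits.Ventures.PercRepro.RankLevelSetLevelSevenT18Dev5
import Summits.Ventures.PercRepro.S4MidKeyEighteen
import Summits.Ventures.PercRepro.S4SevenWindow
import Summits.Ventures.PercRepro.RankLevelSetLevelSixRowsNineToFifteen

/-!
# PercRepro — THE 18 ROW OF LEVEL `7`: `c025_core_seven_eighteen (d ≥ 8) : RLS M 18 7` ON EVERY `e`-FREE CORE OF RANK `18`, AND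
**THEOREM C₇ AT RANK `18`** (p7 g25, S4 feeder; p8's assembly shape — NO window claim, p9 owns S4)

The core cells `(18, d)`: `8 ≤ d ≤ 75` by the coloop device with the lossy ladder (`c025_core_seven_eighteen_<d>`: `k` coloops reduce to the natural cell
`(18 − k, d)` of the row `18 − k` at the same corank, the rest retired — the generic device `c025_core_seven_of_cells_free` in RankLevelSetLevelSevenT18Dev1, RankLevelSetLevelSevenT18Dev2, RankLevelSetLevelSevenT18Dev3, RankLevelSetLevelSevenT18Dev4, RankLevelSetLevelSevenT18Dev5),
`d ≥ 76` by p1's middle key (`S4Mid.c025_core_seven_midkey_eighteen`, no coloop-freeness needed). Then the level-6 glue `rls_seven_at_of_core 18` on `c025_six_all`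
(level `6` at `p = 17`) gives level `7` at `p = 18`: **`c025_seven_at_eighteen : RLS M 18 7`** for every finite matroid.
Axioms: standard.
-/

open scoped Matroid

namespace PercRepro

namespace ThmN

variable {α : Type}

/-- **The core cell `(18, d)` at every corank `d ≥ 8`, every `e`-free core.** -/
theorem c025_core_seven_eighteen (M : Matroid α) [M.Finite] (d : ℕ) (hd8 : 8 ≤ d)
    (hR : M.eRank = (18 : ℕ∞)) (hn : M.E.ncard = 18 + d)
    (hfree : ∀ e ∈ M.E, ∃ A ⊆ M.E \ {e}, e ∉ M.closure A ∧ e ∉ M.closure ((M.E \ {e}) \ A)) :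
    RLS M 18 7 := by
  rcases Nat.lt_or_ge d 76 with hlt | hge
  · interval_cases d
    · exact c025_core_seven_eighteen_8 M hR hn hfree
    · exact c025_core_seven_eighteen_9 M hR hn hfree
    · exact c025_core_seven_eighteen_10 M hR hn hfree
    · exact c025_core_seven_eighteen_11 M hR hn hfree
    · exact c025_core_seven_eighteen_12 M hR hn hfree
    · exact c025_core_seven_eighteen_13 M hR hn hfree
    · exact c025_core_seven_eighteen_14 M hR hn hfree
    · exact c025_core_seven_eighteen_15 M hR hn hfree
    · exact c025_core_seven_eighteen_16 M hR hn hfree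
    · exact c025_core_seven_eighteen_17 M hR hn hfree
    · exact c025_core_seven_eighteen_18 M hR hn hfree
    · exact c025_core_seven_eighteen_19 M hR hn hfree
    · exact c025_core_seven_eighteen_20 M hR hn hfree
    · exact c025_core_seven_eighteen_21 M hR hn hfree
    · exact c025_core_seven_eighteen_22 M hR hn hfree
    · exact c025_core_seven_eighteen_23 M hR hn hfree
    · exact c025_core_seven_eighteen_24 M hR hn hfree
    · exact c025_core_seven_eighteen_25 M hR hn hfree
    · exact c025_core_seven_eighteen_26 M hR hn hfree
    · exact c025_core_seven_eighteen_27 M hR hn hfree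
    · exact c025_core_seven_eighteen_28 M hR hn hfree
    · exact c025_core_seven_eighteen_29 M hR hn hfree
    · exact c025_core_seven_eighteen_30 M hR hn hfree
    · exact c025_core_seven_eighteen_31 M hR hn hfree
    · exact c025_core_seven_eighteen_32 M hR hn hfree
    · exact c025_core_seven_eighteen_33 M hR hn hfree
    · exact c025_core_seven_eighteen_34 M hR hn hfree
    · exact c025_core_seven_eighteen_35 M hR hn hfree
    · exact c025_core_seven_eighteen_36 M hR hn hfree
    · exact c025_core_seven_eighteen_37 M hR hn hfree
    · exact c025_core_seven_eighteen_38 M hR hn hfree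
    · exact c025_core_seven_eighteen_39 M hR hn hfree
    · exact c025_core_seven_eighteen_40 M hR hn hfree
    · exact c025_core_seven_eighteen_41 M hR hn hfree
    · exact c025_core_seven_eighteen_42 M hR hn hfree
    · exact c025_core_seven_eighteen_43 M hR hn hfree
    · exact c025_core_seven_eighteen_44 M hR hn hfree
    · exact c025_core_seven_eighteen_45 M hR hn hfree
    · exact c025_core_seven_eighteen_46 M hR hn hfree
    · exact c025_core_seven_eighteen_47 M hR hn hfree
    · exact c025_core_seven_eighteen_48 M hR hn hfree
    · exact c025_core_seven_eighteen_49 M hR hn hfree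
    · exact c025_core_seven_eighteen_50 M hR hn hfree
    · exact c025_core_seven_eighteen_51 M hR hn hfree
    · exact c025_core_seven_eighteen_52 M hR hn hfree
    · exact c025_core_seven_eighteen_53 M hR hn hfree
    · exact c025_core_seven_eighteen_54 M hR hn hfree
    · exact c025_core_seven_eighteen_55 M hR hn hfree
    · exact c025_core_seven_eighteen_56 M hR hn hfree
    · exact c025_core_seven_eighteen_57 M hR hn hfree
    · exact c025_core_seven_eighteen_58 M hR hn hfree
    · exact c025_core_seven_eighteen_59 M hR hn hfree
    · exact c025_core_seven_eighteen_60 M hR hn hfree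
    · exact c025_core_seven_eighteen_61 M hR hn hfree
    · exact c025_core_seven_eighteen_62 M hR hn hfree
    · exact c025_core_seven_eighteen_63 M hR hn hfree
    · exact c025_core_seven_eighteen_64 M hR hn hfree
    · exact c025_core_seven_eighteen_65 M hR hn hfree
    · exact c025_core_seven_eighteen_66 M hR hn hfree
    · exact c025_core_seven_eighteen_67 M hR hn hfree
    · exact c025_core_seven_eighteen_68 M hR hn hfree
    · exact c025_core_seven_eighteen_69 M hR hn hfree
    · exact c025_core_seven_eighteen_70 M hR hn hfree
    · exact c025_core_seven_eighteen_71 M hR hn hfree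
    · exact c025_core_seven_eighteen_72 M hR hn hfree
    · exact c025_core_seven_eighteen_73 M hR hn hfree
    · exact c025_core_seven_eighteen_74 M hR hn hfree
    · exact c025_core_seven_eighteen_75 M hR hn hfree
  · exact S4Mid.c025_core_seven_midkey_eighteen M (by omega) hfree

/-- **THEOREM C₇ AT RANK `18`**: level `7` at `p = 18` for every finite matroid (on level `6` at `p = 17`, `c025_six_all`). -/
theorem c025_seven_at_eighteen (M : Matroid α) [M.Finite] : RLS M 18 7 :=
  rls_seven_at_of_core 18 (by norm_num) (fun M _ => c025_six_all M 17 (by norm_num))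
    (fun M _ d hd hR hn hfree => c025_core_seven_eighteen M d hd hR hn hfree) M

end ThmN

end PercRepro
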